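import Literature.NumberTheory.Automorphic.Liu2021.Def411WeilCarriersGaloisTwistQuot
import Literature.NumberTheory.GelbartRogawski1991.LocalMpGaloisTwist
import HarnessLib

/-!
# [Liu2021, Thm 4.18 (3)] road, piece III-11a (assembly, layer B): the Galois twist `f ↦ σ ∘ f` followed by a transport of the twisted
# package to the member at the line `⟨t a⟩` is a semilinear oscillator intertwiner — hence a semilinear bijection of the `χ`-quotients

Topic `NumberTheory/Automorphic/Liu2021`; namespace `Literature.NumberTheory.Automorphic.Liu2021.Def411WeilCarriers` (sequel of
`Def411WeilCarriersGaloisTwistQuot.lean`).  KERNEL ONLY: theorems; no definition, no named fact, no `sorry`.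

For members `i₀`, `i₁` of the indexed family at `v` (`localIndexedFamilyAtV`), mutually inverse field endomorphisms `τ, τ'` of `ℂ` (an automorphism
`σ` and `σ⁻¹`), `κ ∈ F_v` with `τ ∘ ψ_v = ψ_v(κ·)` and the global centre characters related by `χ_{i₁} = τ ∘ χ_{i₀}`: IF a `ℂ`-linear automorphism
`D` of `𝒮(F_vⁿ)` TRANSPORTS the Galois-twisted package of member `i₀` to the package of member `i₁` along the embedding of `U(J_V)(F_v)` —
`D (ω_κ(galTwist (s_{i₀}(g ⊗ 1))) f) = ω_{s_{i₁}}(g ⊗ 1) (D f)` (hypothesis `hT`; in the road this is the dilation `D_s` of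
`SchrodingerAddCharDilation`/`LocalMpAddCharRescaling` [piece P4] combined with the `σ`-stability of the μ-normalised splitting [piece P3b]),
THEN `Φ := D ∘ (f ↦ τ ∘ f)` is a bijective `τ`-semilinear intertwiner `ω_{i₀} → ω_{i₁}` (`LocalMp.toRep_galTwist_schwartzGalConj`), and layer A
(`exists_semilinear_quot_of_omega_intertwiner`) yields the bijective `τ`-semilinear `U(J_V)(F_v)`-map of the Step-3 quotients
`ω(μ_{i₀}, ε_{i₀}, χ_{i₀}) → ω(μ_{i₁}, ε_{i₁}, χ_{i₁})` — the conclusion of the face Prop `LocalTypeGaloisTwist` of the cell `hodgecm-mathlib`, modulo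
the single transport identity `hT`.
HC_CM is proved only modulo the 7 printed citations until rung 0 of the ladder closes; nothing about it is claimed here.

## References
* [Liu2021] Y. Liu, Camb. J. Math. 9 (2021), Thm. 4.18 (3) with proof l. 2272–2289; App. D §D.1 Steps 1–3.
* [MoeglinVignerasWaldspurger1987] C. Mœglin, M.-F. Vignéras, J.-L. Waldspurger, LNM 1291, Chap. 2 II.1 (transport of structure).
-/

set_option autoImplicit false

noncomputable section

open scoped Matrix Kronecker RestrictedProduct NumberField Classical
open NumberField IsDedekindDomain Filter Set
open Literature.NumberTheory Literature.NumberTheory.Automorphic Literature.NumberTheory.Automorphic.UnitaryGroup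
open Literature.NumberTheory.GelbartRogawski1991 Literature.NumberTheory.GelbartRogawski1991.UnitaryDualPair
open Literature.NumberTheory.GelbartRogawski1991.UnitaryDualPair.LocalSplitting
open Literature.RepresentationTheory Literature.RepresentationTheory.HeisenbergGroup
open Literature.RepresentationTheory.CentralCharacterQuotient (augmentation)

namespace Literature.NumberTheory.Automorphic.Liu2021.Def411WeilCarriers

variable (F E : Type) [Field F] [NumberField F] [Field E] [NumberField E] [Algebra F E]
variable (c : E ≃ₐ[F] E) (N : ℕ) {n : ℕ} (e : Fin N × Fin 1 ≃ Fin n)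
variable (JV : Matrix (Fin N) (Fin N) E) {TV : Matrix (Fin N) (Fin N) F}
variable [Algebra.IsQuadraticExtension F E] {δ : E} (hcδ : c δ = -δ) (hδ : δ ≠ 0) {d : F} (hd : δ * δ = algebraMap F E d)

/-- unfolding: `ω_i(g) f = ω_{s_i}(g ⊗ 1) f` — the oscillator representation of member `i` is the Weil representation of its splitting read
on `U(J_V)(F_v)` through `uEquiv` and the line embedding `localLineInl`. [cite: Liu2021, App. D §D.1 Steps 1–2 (l. 5217–5219)] -/
theorem localIndexedFamilyAtV_omega_apply (hV : TV.IsSymm) (hVd : IsUnit TV.det)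
    (hJV : JV = TV.map (algebraMap F E))
    (hn : 3 ≤ n) {ι : Type} (aOf : ι → Fˣ) (χOf : ι → Chi F E c)
    (𝓢Of : ∀ i, LocalSplitting.FinLocalSplittings F E c n hcδ hδ hd (gram F e TV (TW F (aOf i))) (isSymm_gram F e hV (isSymm_TW F (aOf i)))
      (reindex_kronecker_eq_gram_map F E e hJV (JW_eq F E (aOf i))))
    (μOf : ι → ∀ v : HeightOneSpectrum (𝓞 F), (LocalRing E v)ˣ →* ℂˣ) (hμn : ∀ i v x, ‖((μOf i v x : ℂˣ) : ℂ)‖ = 1)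
    (hμc : ∀ i v, Continuous fun x => ((μOf i v x : ℂˣ) : ℂ))
    (hμF : ∀ (i : ι) (v : HeightOneSpectrum (𝓞 F)) (t : (v.adicCompletion F)ˣ),
      μOf i v (Units.map (algebraMap (v.adicCompletion F) (LocalRing E v)).toMonoidHom t) = 1 ↔
        ∃ x : (LocalRing E v)ˣ, (x : LocalRing E v) * conjLocal E c v x = algebraMap (v.adicCompletion F) (LocalRing E v) t)
    (v : HeightOneSpectrum (𝓞 F)) (i : ι)
    (g : (localIndexedFamilyAtV F E c N e JV hcδ hδ hd hV hVd hJV hn aOf χOf 𝓢Of μOf hμn hμc hμF v).S.U)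
    (f : SchwartzBruhat (Fin n → v.adicCompletion F)) :
    (localIndexedFamilyAtV F E c N e JV hcδ hδ hd hV hVd hJV hn aOf χOf 𝓢Of μOf hμn hμc hμF v).omega i g f =
      MpPsi.toRep (localSchrodinger F n (gram F e TV (TW F (aOf i))) v)
        ((𝓢Of i).s v (localLineInl E c N e JV (JW F E (aOf i)) v
          (LemD1OfPlace.uEquiv E v c N JV hcδ hδ
            (localIndexedFamilyAtV F E c N e JV hcδ hδ hd hV hVd hJV hn aOf χOf 𝓢Of μOf hμn hμc hμF v).S.two_le
            (transpose_map_conj_JV F E c N JV hV hJV) (det_JV_ne_zero F E N JV hVd hJV) g))) f :=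
  rfl

/-- **III-11a, LAYER B — TWIST THEN TRANSPORT.**  Members `i₀`, `i₁` of the indexed family at `v`; `τ, τ'` mutually inverse field endomorphisms
of `ℂ`; `κ ∈ F_v` with `τ ∘ ψ_v = ψ_v(κ·)`; the global centre characters satisfy `χ_{i₁} = τ ∘ χ_{i₀}`; and a `ℂ`-linear automorphism `D` of
`𝒮(F_vⁿ)` transports the `τ`-twisted package of member `i₀` (`LocalMp.galTwist`, at the character `ψ_v(κ·)`) to the package of member `i₁` along
`U(J_V)(F_v)` (`hT`).  Then there is a bijective `τ`-semilinear map of the Step-3 quotients `ω(μ_{i₀}, ε_{i₀}, χ_{i₀}) → ω(μ_{i₁}, ε_{i₁}, χ_{i₁})`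
intertwining the `U(J_V)(F_v)`-actions (the intertwiner of the oscillator representations is `D ∘ (f ↦ τ ∘ f)`).
[cite: Liu2021, Thm. 4.18 (3), proof l. 2272–2289] [cite: MoeglinVignerasWaldspurger1987, Chap. 2 II.1 (transport of structure)] -/
theorem exists_semilinear_quot_of_galTwist_transport (hV : TV.IsSymm) (hVd : IsUnit TV.det)
    (hJV : JV = TV.map (algebraMap F E))
    (hn : 3 ≤ n) {ι : Type} (aOf : ι → Fˣ) (χOf : ι → Chi F E c)
    (𝓢Of : ∀ i, LocalSplitting.FinLocalSplittings F E c n hcδ hδ hd (gram F e TV (TW F (aOf i))) (isSymm_gram F e hV (isSymm_TW F (aOf i)))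
      (reindex_kronecker_eq_gram_map F E e hJV (JW_eq F E (aOf i))))
    (μOf : ι → ∀ v : HeightOneSpectrum (𝓞 F), (LocalRing E v)ˣ →* ℂˣ) (hμn : ∀ i v x, ‖((μOf i v x : ℂˣ) : ℂ)‖ = 1)
    (hμc : ∀ i v, Continuous fun x => ((μOf i v x : ℂˣ) : ℂ))
    (hμF : ∀ (i : ι) (v : HeightOneSpectrum (𝓞 F)) (t : (v.adicCompletion F)ˣ),
      μOf i v (Units.map (algebraMap (v.adicCompletion F) (LocalRing E v)).toMonoidHom t) = 1 ↔
        ∃ x : (LocalRing E v)ˣ, (x : LocalRing E v) * conjLocal E c v x = algebraMap (v.adicCompletion F) (LocalRing E v) t)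
    (v : HeightOneSpectrum (𝓞 F)) (i₀ i₁ : ι) (τ τ' : ℂ →+* ℂ) (hττ' : ∀ z, τ (τ' z) = z) (hτ'τ : ∀ z, τ' (τ z) = z)
    (hχ : ∀ u : finAdelicOne F E c, ((((χOf i₁).1 u : ℂˣ)) : ℂ) = τ ((((χOf i₀).1 u : ℂˣ)) : ℂ))
    (κ : v.adicCompletion F)
    (hκ : ∀ r : v.adicCompletion F, τ ((adeleAddCharAt F v r : Circle) : ℂ) = ((adeleAddCharAt F v (κ * r) : Circle) : ℂ))
    (D : SchwartzBruhat (Fin n → v.adicCompletion F) ≃ₗ[ℂ] SchwartzBruhat (Fin n → v.adicCompletion F))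
    (hT : ∀ (g : (localIndexedFamilyAtV F E c N e JV hcδ hδ hd hV hVd hJV hn aOf χOf 𝓢Of μOf hμn hμc hμF v).S.U)
      (f : SchwartzBruhat (Fin n → v.adicCompletion F)),
      D (MpPsi.toRep (localSchrodingerMulShift F n (gram F e TV (TW F (aOf i₀))) v κ)
          (LocalMp.galTwist F n (gram F e TV (TW F (aOf i₀))) v τ τ' hττ' hτ'τ κ hκ
            ((𝓢Of i₀).s v (localLineInl E c N e JV (JW F E (aOf i₀)) v
              (LemD1OfPlace.uEquiv E v c N JV hcδ hδ
                (localIndexedFamilyAtV F E c N e JV hcδ hδ hd hV hVd hJV hn aOf χOf 𝓢Of μOf hμn hμc hμF v).S.two_le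
                (transpose_map_conj_JV F E c N JV hV hJV) (det_JV_ne_zero F E N JV hVd hJV) g)))) f) =
        MpPsi.toRep (localSchrodinger F n (gram F e TV (TW F (aOf i₁))) v)
          ((𝓢Of i₁).s v (localLineInl E c N e JV (JW F E (aOf i₁)) v
            (LemD1OfPlace.uEquiv E v c N JV hcδ hδ
              (localIndexedFamilyAtV F E c N e JV hcδ hδ hd hV hVd hJV hn aOf χOf 𝓢Of μOf hμn hμc hμF v).S.two_le
              (transpose_map_conj_JV F E c N JV hV hJV) (det_JV_ne_zero F E N JV hVd hJV) g))) (D f)) :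
    ∃ h : ((localIndexedFamilyAtV F E c N e JV hcδ hδ hd hV hVd hJV hn aOf χOf 𝓢Of μOf hμn hμc hμF v).V i₀ ⧸
          augmentation ((localIndexedFamilyAtV F E c N e JV hcδ hδ hd hV hVd hJV hn aOf χOf 𝓢Of μOf hμn hμc hμF v).omega i₀)
            (localIndexedFamilyAtV F E c N e JV hcδ hδ hd hV hVd hJV hn aOf χOf 𝓢Of μOf hμn hμc hμF v).S.scalar
            ((localIndexedFamilyAtV F E c N e JV hcδ hδ hd hV hVd hJV hn aOf χOf 𝓢Of μOf hμn hμc hμF v).chi i₀).1) →ₛₗ[τ]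
        ((localIndexedFamilyAtV F E c N e JV hcδ hδ hd hV hVd hJV hn aOf χOf 𝓢Of μOf hμn hμc hμF v).V i₁ ⧸
          augmentation ((localIndexedFamilyAtV F E c N e JV hcδ hδ hd hV hVd hJV hn aOf χOf 𝓢Of μOf hμn hμc hμF v).omega i₁)
            (localIndexedFamilyAtV F E c N e JV hcδ hδ hd hV hVd hJV hn aOf χOf 𝓢Of μOf hμn hμc hμF v).S.scalar
            ((localIndexedFamilyAtV F E c N e JV hcδ hδ hd hV hVd hJV hn aOf χOf 𝓢Of μOf hμn hμc hμF v).chi i₁).1),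
      Function.Bijective h ∧
      ∀ g x, h ((localIndexedFamilyAtV F E c N e JV hcδ hδ hd hV hVd hJV hn aOf χOf 𝓢Of μOf hμn hμc hμF v).quot i₀ g x) =
        (localIndexedFamilyAtV F E c N e JV hcδ hδ hd hV hVd hJV hn aOf χOf 𝓢Of μOf hμn hμc hμF v).quot i₁ g (h x) := by
  refine exists_semilinear_quot_of_omega_intertwiner F E c N e JV hcδ hδ hd hV hVd hJV hn aOf χOf 𝓢Of μOf hμn hμc hμF v i₀ i₁ τ hχ
    ((D : SchwartzBruhat (Fin n → v.adicCompletion F) →ₗ[ℂ] SchwartzBruhat (Fin n → v.adicCompletion F)).comp (schwartzGalConj τ))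
    (D.bijective.comp (schwartzGalConj_bijective τ τ' hττ')) fun g f => ?_
  rw [LinearMap.comp_apply, LinearMap.comp_apply, LinearEquiv.coe_coe, localIndexedFamilyAtV_omega_apply,
    localIndexedFamilyAtV_omega_apply,
    ← LocalMp.toRep_galTwist_schwartzGalConj F n (gram F e TV (TW F (aOf i₀))) v τ τ' hττ' hτ'τ κ hκ, hT]

end Literature.NumberTheory.Automorphic.Liu2021.Def411WeilCarriers

end
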